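import Summits.BirchSwinnertonDyer.BirchSwinnertonDyer.Theorems.KolyvaginRoadThreeMethod2EvenLevels
import HarnessLib

/-!
# Route `AdditiveKolyvaginRoad`, crux `LevelKolyvaginSystemsAdditive` (item stmt-BirchSwinnertonDyer-21396, KS′):
# RIGIDITY of a bipartite ∕ level Kolyvagin system over a FIELD along HOWARD'S CORE GRAPH — abstract core
# (cell `pub/bsd-wall`, width seat `bsd-wall-akr-p2x-w2` g2; `--supports stmt-BirchSwinnertonDyer-21396`, helper; part 1 of 3 —
# part 2 `…LevelSystemsRigidity` instantiates it for the carrier `LevelKolyvaginSystemP`, part 3 `…LevelSystemsOfIgnition`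
# assembles KS′'s conclusion from ONE ignition + connectivity)

WHY. The carrier `LevelKolyvaginSystemP W K p Dt β ι c` (`Theorems/AdditiveKolyvaginRoadLevelSystems.lean`) carries the
open content of KS′ in two fields (lead akr-p2x g0, CARRIER-AUDIT; vet akr3): `transport` (W. Zhang 2014 Thm. 4.3) and
`baseCase` (Thm. 7.2: `c(1, n) ≠ 0` at every EVEN non-empty level `n` of canonical rank one). The landed dictionaries feed
`baseCase` from a rank-0 ANCHOR at the odd (definite) levels — (γ) «`Sel_{n'} = 0 ⟹ λ(∅, n') ≠ 0`» (w2,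
`baseCase_of_oddLevelAnchor`) or its λ-free form (FF) (w3, `ne_zero_of_rankLowering_of_firstFloor`) — asked AT EVERY SUCH
LEVEL; at `p² ∣ N` that anchor is the unprinted Skinner–Urban-type input for the level-raised forms of E's additive type
(DEAD-LINES D2/D3; line `birth` died there). Howard's RIGIDITY for bipartite Euler systems over a principal Artinian ring `R`
(Crelle 597 (2006) §2.3–2.5, after Mazur–Rubin) says far less is needed: a global section of the stub sheaf on the graph of
levels is determined by its value at ANY ONE core vertex (Cor. 2.4.12), because (i) across an edge `n — n ∪ {q}` whose ODD
end is a CORE vertex the two stubs are identified (Cor. 2.3.5 with Lemma 2.3.3), and (ii) the core subgraph is connected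
(Prop. 2.4.11). Over the residue FIELD `R/𝔪 = 𝔽_p` — the currency of the route (classes in `H¹(K, E[p])`, canonical spaces
`Sel_n^± ⊗ 𝔽_p`) — «generates the stub» is just «is non-zero», and (i) is ELEMENTARY: it needs only the two Bertolini–Darmon
reciprocity laws read two-sidedly («`≠ 0 ⟺ ≠ 0`», BD05 Thms 4.1 ∕ 4.2 being equalities up to units) and the bookkeeping «a
class locally trivial above `q` passes between `Sel_n` and `Sel_{n∪q}`». THIS FILE is (i) and its propagation along paths, in
ENGINE currency (any semiring of scalars, any ambient group `H`, level spaces `Sel : Finset Q → Bool → Submodule F H`, any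
«locally trivial above `q`» predicate `T`), so that it serves every level-system line of the tree (this route at `p ≥ 5`,
zhang3's `Method2` at `p = 3`). What is NOT here: (ii) CONNECTIVITY (Howard Lemma 2.4.10 ∕ Prop. 2.4.11: Čebotarev choices +
the global-duality dichotomy `ρ(n∪q) = ρ(n) ± 1`) — it is the consumer's explicit hypothesis in parts 2–3, where (A1)
(landed) supplies its first brick.

CONTENTS (namespace `Summit.BirchSwinnertonDyer.Rank1Residual.X11b.Three.Koly.CoreGraph`; all relations stated INLINE —
no definition is introduced).
* §1 the two EDGE LEMMAS `ne_zero_iff_value_above` ∕ `ne_zero_iff_value_below` (even vertex below ∕ above an odd CORE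
  vertex: `κ(even end) ≠ 0 ⟺ λ(odd end) ≠ 0`), the PROPAGATION `propagate_of_eqvGen` along `Relation.EqvGen` of the
  core-edge relation «`b = a ∪ {q}`, the odd end has both canonical spaces `0`», and its consumer forms `ne_zero_of_eqvGen`
  (class ⟹ class), `value_of_eqvGen` (class ⟹ value), `ne_zero_of_eqvGen_of_value` (ONE value ⟹ class).
* §1b the CONGRUENCE form for producers who give only W. Zhang's Thm 4.3 (two localisations two levels apart agree — w3's
  (SRL) binder): the graph coarsened to RUNGS `n — n ∪ {q₁, q₂}` through an odd core vertex `n ∪ {q₁}`: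
  `ne_zero_iff_of_rung`, `even_iff_and_ne_zero_iff_of_eqvGen_rung`, `ne_zero_of_eqvGen_rung`.

HONEST FRAMING: theorems only, pure algebra (Mathlib `Submodule`, `Finset`, `Relation.EqvGen`); 0 definitions, 0 named
facts, 0 `sorry`; every law is a HYPOTHESIS; closes nothing. BSD is not proved by any of this.

References: [cite: Howard2006Bipartite, Lemma 2.3.3, Cor. 2.3.5, Def. 2.4.2, Lemma 2.4.4, Cor. 2.4.12, Thm. 2.5.1]
[cite: WZhang2014, Thm. 4.3, Thm. 7.2, §9] [cite: BertoliniDarmon2005, Thm. 4.1, Thm. 4.2].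
-/

noncomputable section

/-! ## §1 Rigidity along Howard's core graph (abstract: any semiring of scalars; a field in use) -/

namespace Summit.BirchSwinnertonDyer.Rank1Residual.X11b.Three.Koly.CoreGraph

variable {F : Type*} [Semiring F] {H : Type*} [AddCommGroup H] [Module F H] {Q : Type*} [DecidableEq Q]
  (Sel : Finset Q → Bool → Submodule F H) (T : Q → H → Prop) (κ : Finset Q → H) (Λ : Finset Q → Prop)

/-- **Edge lemma, even vertex BELOW an odd core vertex** (Howard 2006, Cor. 2.3.5 with Lemma 2.3.3 (c) over the residue
field). Data: level spaces `Sel n μ`, a «locally trivial above `q`» predicate `T q` with `T q 0` and the bookkeeping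
«`y ∈ Sel_n^μ` locally trivial above a new `q` lies in `Sel_{n∪q}^μ`», even-level classes `κ`, odd-level value predicates
`Λ` («`λ(n')` is a unit») tied by the TWO-SIDED first law (A) «the finite part of `κ(n)` at a new `q` vanishes iff
`λ(n ∪ q)` does». If `n` is even, `q ∉ n`, `κ(n) ∈ Sel_n^μ` and the odd vertex above is CORE in the sign `μ`
(`Sel_{n∪q}^μ = 0`), then `κ(n) ≠ 0 ⟺ λ(n ∪ q) ≠ 0` (a non-zero class of `Sel_n^μ` locally trivial above `q` would be a
class of `Sel_{n∪q}^μ = 0`). [cite: Howard2006Bipartite, Lemma 2.3.3, Cor. 2.3.5] [cite: BertoliniDarmon2005, Thm. 4.2] -/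
theorem ne_zero_iff_value_above
    (hIn : ∀ (n : Finset Q) (q : Q) (μ : Bool) (y : H), q ∉ n → y ∈ Sel n μ → T q y → y ∈ Sel (insert q n) μ)
    (hT0 : ∀ q, T q 0)
    (lawA : ∀ (n : Finset Q) (q : Q), Even n.card → q ∉ n → (¬ T q (κ n) ↔ Λ (insert q n)))
    {n : Finset Q} {q : Q} (hn : Even n.card) (hqn : q ∉ n) {μ : Bool} (hmem : κ n ∈ Sel n μ)
    (hcore : Sel (insert q n) μ = ⊥) : κ n ≠ 0 ↔ Λ (insert q n) := by
  rw [← lawA n q hn hqn]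
  refine ⟨fun h0 hT ↦ ?_, fun hT h0 ↦ hT (by rw [h0]; exact hT0 q)⟩
  have h := hIn n q μ (κ n) hqn hmem hT
  rw [hcore, Submodule.mem_bot] at h
  exact h0 h

/-- **Edge lemma, even vertex ABOVE an odd core vertex** (Howard 2006, Cor. 2.3.5 with Lemma 2.3.3 (b) over the residue
field): with the bookkeeping «`z ∈ Sel_{n'∪q}^μ` locally trivial above `q` lies in `Sel_{n'}^μ`» and the TWO-SIDED second
law (B) «the (toric) localisation of `κ(n' ∪ q)` at the level prime `q` vanishes iff `λ(n')` does»: if `n'` is odd,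
`q ∉ n'`, `κ(n'∪q) ∈ Sel_{n'∪q}^μ` and `n'` is CORE in the sign `μ` (`Sel_{n'}^μ = 0`), then `κ(n' ∪ q) ≠ 0 ⟺ λ(n') ≠ 0`.
[cite: Howard2006Bipartite, Lemma 2.3.3, Cor. 2.3.5] [cite: BertoliniDarmon2005, Thm. 4.1] -/
theorem ne_zero_iff_value_below
    (hOut : ∀ (n : Finset Q) (q : Q) (μ : Bool) (z : H), q ∉ n → z ∈ Sel (insert q n) μ → T q z → z ∈ Sel n μ)
    (hT0 : ∀ q, T q 0)
    (lawB : ∀ (n' : Finset Q) (q : Q), Odd n'.card → q ∉ n' → (¬ T q (κ (insert q n')) ↔ Λ n'))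
    {n' : Finset Q} {q : Q} (hn' : Odd n'.card) (hqn' : q ∉ n') {μ : Bool}
    (hmem : κ (insert q n') ∈ Sel (insert q n') μ) (hcore : Sel n' μ = ⊥) : κ (insert q n') ≠ 0 ↔ Λ n' := by
  rw [← lawB n' q hn' hqn']
  refine ⟨fun h0 hT ↦ ?_, fun hT h0 ↦ hT (by rw [h0]; exact hT0 q)⟩
  have h := hOut n' q μ (κ (insert q n')) hqn' hmem hT
  rw [hcore, Submodule.mem_bot] at h
  exact h0 h

/-- **PROPAGATION along Howard's core graph** (Howard 2006, §2.4: a global section of the stub sheaf is determined by its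
value at any vertex of a connected piece of the core subgraph; over the residue field «generates the stub» = «is non-zero»).
The CORE-EDGE relation (stated inline): `a — a ∪ {q}` for a new `q`, the ODD endpoint having BOTH canonical spaces zero.
Along its equivalence closure `Relation.EqvGen`, the predicate «`κ ≠ 0` if the level is even, `λ ≠ 0` if it is odd» is
INVARIANT, granted the laws (A), (B) two-sidedly, the two bookkeeping rules, and `κ(n) ∈ Sel_n^{some sign}` at even `n`.
[cite: Howard2006Bipartite, Cor. 2.3.5, Lemma 2.4.4, Cor. 2.4.12] -/
theorem propagate_of_eqvGen
    (hIn : ∀ (n : Finset Q) (q : Q) (μ : Bool) (y : H), q ∉ n → y ∈ Sel n μ → T q y → y ∈ Sel (insert q n) μ)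
    (hOut : ∀ (n : Finset Q) (q : Q) (μ : Bool) (z : H), q ∉ n → z ∈ Sel (insert q n) μ → T q z → z ∈ Sel n μ)
    (hT0 : ∀ q, T q 0)
    (lawA : ∀ (n : Finset Q) (q : Q), Even n.card → q ∉ n → (¬ T q (κ n) ↔ Λ (insert q n)))
    (lawB : ∀ (n' : Finset Q) (q : Q), Odd n'.card → q ∉ n' → (¬ T q (κ (insert q n')) ↔ Λ n'))
    (hmem : ∀ n : Finset Q, Even n.card → ∃ μ, κ n ∈ Sel n μ) {a b : Finset Q}
    (h : Relation.EqvGen (fun a b : Finset Q ↦ ∃ q, q ∉ a ∧ b = insert q a ∧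
        (Even a.card → Sel (insert q a) true = ⊥ ∧ Sel (insert q a) false = ⊥) ∧
        (Odd a.card → Sel a true = ⊥ ∧ Sel a false = ⊥)) a b) :
    ((Even a.card → κ a ≠ 0) ∧ (Odd a.card → Λ a)) ↔ ((Even b.card → κ b ≠ 0) ∧ (Odd b.card → Λ b)) := by
  induction h with
  | rel x y hxy =>
    obtain ⟨q, hqx, rfl, hev, hod⟩ := hxy
    rcases Nat.even_or_odd x.card with hx | hx
    · -- `x` even, below the odd core vertex `x ∪ {q}`
      obtain ⟨htrue, hfalse⟩ := hev hx
      obtain ⟨μ, hμ⟩ := hmem x hx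
      have hbot : Sel (insert q x) μ = ⊥ := by
        cases μ
        · exact hfalse
        · exact htrue
      have key := ne_zero_iff_value_above Sel T κ Λ hIn hT0 lawA hx hqx hμ hbot
      have hy : Odd (insert q x).card := by rw [Finset.card_insert_of_notMem hqx]; exact hx.add_one
      have hy' : ¬ Even (insert q x).card := Nat.not_even_iff_odd.mpr hy
      have hx' : ¬ Odd x.card := Nat.not_odd_iff_even.mpr hx
      exact ⟨fun h ↦ ⟨fun he ↦ absurd he hy', fun _ ↦ key.mp (h.1 hx)⟩,
        fun h ↦ ⟨fun _ ↦ key.mpr (h.2 hy), fun ho ↦ absurd ho hx'⟩⟩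
    · -- `x` odd core, `x ∪ {q}` even above it
      obtain ⟨htrue, hfalse⟩ := hod hx
      have hy : Even (insert q x).card := by rw [Finset.card_insert_of_notMem hqx]; exact hx.add_one
      obtain ⟨μ, hμ⟩ := hmem _ hy
      have hbot : Sel x μ = ⊥ := by
        cases μ
        · exact hfalse
        · exact htrue
      have key := ne_zero_iff_value_below Sel T κ Λ hOut hT0 lawB hx hqx hμ hbot
      have hy' : ¬ Odd (insert q x).card := Nat.not_odd_iff_even.mpr hy
      have hx' : ¬ Even x.card := Nat.not_even_iff_odd.mpr hx
      exact ⟨fun h ↦ ⟨fun _ ↦ key.mpr (h.2 hx), fun ho ↦ absurd ho hy'⟩,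
        fun h ↦ ⟨fun he ↦ absurd he hx', fun _ ↦ key.mp (h.1 hy)⟩⟩
  | refl x => exact Iff.rfl
  | symm x y _ ih => exact ih.symm
  | trans x y z _ _ ih₁ ih₂ => exact ih₁.trans ih₂

/-- **Class ⟹ class**: a non-zero class at ONE even vertex `n₀` forces `κ(n) ≠ 0` at every even vertex `n` of the same
connected piece of the core graph. [cite: Howard2006Bipartite, Cor. 2.4.12, Thm. 2.5.1] -/
theorem ne_zero_of_eqvGen
    (hIn : ∀ (n : Finset Q) (q : Q) (μ : Bool) (y : H), q ∉ n → y ∈ Sel n μ → T q y → y ∈ Sel (insert q n) μ)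
    (hOut : ∀ (n : Finset Q) (q : Q) (μ : Bool) (z : H), q ∉ n → z ∈ Sel (insert q n) μ → T q z → z ∈ Sel n μ)
    (hT0 : ∀ q, T q 0)
    (lawA : ∀ (n : Finset Q) (q : Q), Even n.card → q ∉ n → (¬ T q (κ n) ↔ Λ (insert q n)))
    (lawB : ∀ (n' : Finset Q) (q : Q), Odd n'.card → q ∉ n' → (¬ T q (κ (insert q n')) ↔ Λ n'))
    (hmem : ∀ n : Finset Q, Even n.card → ∃ μ, κ n ∈ Sel n μ) {n₀ n : Finset Q} (hn₀ : Even n₀.card)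
    (h0 : κ n₀ ≠ 0) (hn : Even n.card)
    (hpath : Relation.EqvGen (fun a b : Finset Q ↦ ∃ q, q ∉ a ∧ b = insert q a ∧
        (Even a.card → Sel (insert q a) true = ⊥ ∧ Sel (insert q a) false = ⊥) ∧
        (Odd a.card → Sel a true = ⊥ ∧ Sel a false = ⊥)) n₀ n) : κ n ≠ 0 :=
  ((propagate_of_eqvGen Sel T κ Λ hIn hOut hT0 lawA lawB hmem hpath).mp
    ⟨fun _ ↦ h0, fun ho ↦ absurd ho (Nat.not_odd_iff_even.mpr hn₀)⟩).1 hn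

/-- **Class ⟹ value**: a non-zero class at one even vertex forces `λ(n') ≠ 0` at every odd vertex `n'` of its connected
piece of the core graph (necessarily a core vertex if it has a neighbour there). [cite: Howard2006Bipartite, Thm. 2.5.1] -/
theorem value_of_eqvGen
    (hIn : ∀ (n : Finset Q) (q : Q) (μ : Bool) (y : H), q ∉ n → y ∈ Sel n μ → T q y → y ∈ Sel (insert q n) μ)
    (hOut : ∀ (n : Finset Q) (q : Q) (μ : Bool) (z : H), q ∉ n → z ∈ Sel (insert q n) μ → T q z → z ∈ Sel n μ)
    (hT0 : ∀ q, T q 0)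
    (lawA : ∀ (n : Finset Q) (q : Q), Even n.card → q ∉ n → (¬ T q (κ n) ↔ Λ (insert q n)))
    (lawB : ∀ (n' : Finset Q) (q : Q), Odd n'.card → q ∉ n' → (¬ T q (κ (insert q n')) ↔ Λ n'))
    (hmem : ∀ n : Finset Q, Even n.card → ∃ μ, κ n ∈ Sel n μ) {n₀ n' : Finset Q} (hn₀ : Even n₀.card)
    (h0 : κ n₀ ≠ 0) (hn' : Odd n'.card)
    (hpath : Relation.EqvGen (fun a b : Finset Q ↦ ∃ q, q ∉ a ∧ b = insert q a ∧
        (Even a.card → Sel (insert q a) true = ⊥ ∧ Sel (insert q a) false = ⊥) ∧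
        (Odd a.card → Sel a true = ⊥ ∧ Sel a false = ⊥)) n₀ n') : Λ n' :=
  ((propagate_of_eqvGen Sel T κ Λ hIn hOut hT0 lawA lawB hmem hpath).mp
    ⟨fun _ ↦ h0, fun ho ↦ absurd ho (Nat.not_odd_iff_even.mpr hn₀)⟩).2 hn'

/-- **ONE value ⟹ class** (the anchor at a SINGLE odd level suffices): a unit value `λ(n₀')` at one odd vertex forces
`κ(n) ≠ 0` at every even vertex of its connected piece of the core graph. [cite: Howard2006Bipartite, Thm. 2.5.1]
[cite: WZhang2014, Thm. 7.2] -/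
theorem ne_zero_of_eqvGen_of_value
    (hIn : ∀ (n : Finset Q) (q : Q) (μ : Bool) (y : H), q ∉ n → y ∈ Sel n μ → T q y → y ∈ Sel (insert q n) μ)
    (hOut : ∀ (n : Finset Q) (q : Q) (μ : Bool) (z : H), q ∉ n → z ∈ Sel (insert q n) μ → T q z → z ∈ Sel n μ)
    (hT0 : ∀ q, T q 0)
    (lawA : ∀ (n : Finset Q) (q : Q), Even n.card → q ∉ n → (¬ T q (κ n) ↔ Λ (insert q n)))
    (lawB : ∀ (n' : Finset Q) (q : Q), Odd n'.card → q ∉ n' → (¬ T q (κ (insert q n')) ↔ Λ n'))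
    (hmem : ∀ n : Finset Q, Even n.card → ∃ μ, κ n ∈ Sel n μ) {n₀' n : Finset Q} (hn₀' : Odd n₀'.card)
    (h0 : Λ n₀') (hn : Even n.card)
    (hpath : Relation.EqvGen (fun a b : Finset Q ↦ ∃ q, q ∉ a ∧ b = insert q a ∧
        (Even a.card → Sel (insert q a) true = ⊥ ∧ Sel (insert q a) false = ⊥) ∧
        (Odd a.card → Sel a true = ⊥ ∧ Sel a false = ⊥)) n₀' n) : κ n ≠ 0 :=
  ((propagate_of_eqvGen Sel T κ Λ hIn hOut hT0 lawA lawB hmem hpath).mp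
    ⟨fun he ↦ absurd he (Nat.not_even_iff_odd.mpr hn₀'), fun _ ↦ h0⟩).1 hn

/-! ### §1b The congruence form: rungs `n — n ∪ {q₁, q₂}` through an odd core vertex (W. Zhang Thm 4.3 as an equivalence) -/

/-- **One RUNG** (W. Zhang's Thm 4.3 read two-sidedly, Howard's two edges `n — n∪q₁ — n∪q₁∪q₂` at once): for an even
level `n`, new `q₁ ∉ n`, `q₂ ∉ n ∪ q₁`, the congruence «`κ(n)` locally trivial above `q₁` ⟺ `κ(n ∪ {q₁,q₂})` locally
trivial above `q₂`», classes in their level spaces at both (even) ends, and the ODD vertex `n ∪ {q₁}` CORE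
(`Sel_{n∪q₁}^+ = Sel_{n∪q₁}^- = 0`): `κ(n) ≠ 0 ⟺ κ(n ∪ {q₁, q₂}) ≠ 0`. (⟹: w3's
`not_mem_torsionLocalKer_of_ne_zero_of_selQP_insert_eq_bot` then the congruence; ⟸ NEW: a class of `Sel_{n∪q₁∪q₂}` locally
trivial above `q₂` is a class of `Sel_{n∪q₁} = 0`.) [cite: WZhang2014, Thm. 4.3, §9] [cite: Howard2006Bipartite, Cor. 2.3.5] -/
theorem ne_zero_iff_of_rung
    (hIn : ∀ (n : Finset Q) (q : Q) (μ : Bool) (y : H), q ∉ n → y ∈ Sel n μ → T q y → y ∈ Sel (insert q n) μ)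
    (hOut : ∀ (n : Finset Q) (q : Q) (μ : Bool) (z : H), q ∉ n → z ∈ Sel (insert q n) μ → T q z → z ∈ Sel n μ)
    (hT0 : ∀ q, T q 0) {n : Finset Q} {q₁ q₂ : Q} (hq₁ : q₁ ∉ n) (hq₂ : q₂ ∉ insert q₁ n)
    (hrec : T q₁ (κ n) ↔ T q₂ (κ (insert q₂ (insert q₁ n)))) {μ μ'' : Bool} (hmem : κ n ∈ Sel n μ)
    (hmem'' : κ (insert q₂ (insert q₁ n)) ∈ Sel (insert q₂ (insert q₁ n)) μ'')
    (htrue : Sel (insert q₁ n) true = ⊥) (hfalse : Sel (insert q₁ n) false = ⊥) :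
    κ n ≠ 0 ↔ κ (insert q₂ (insert q₁ n)) ≠ 0 := by
  have hbot : ∀ ν, Sel (insert q₁ n) ν = ⊥ := fun ν ↦ by
    cases ν
    · exact hfalse
    · exact htrue
  refine ⟨fun h0 h ↦ ?_, fun h0 h ↦ ?_⟩
  · -- up: `κ(n)` is not locally trivial above `q₁`, so `κ(n q₁ q₂)` is not above `q₂`
    have hT : T q₂ (κ (insert q₂ (insert q₁ n))) := by rw [h]; exact hT0 q₂
    have h' := hIn n q₁ μ (κ n) hq₁ hmem (hrec.mpr hT)
    rw [hbot μ, Submodule.mem_bot] at h'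
    exact h0 h'
  · -- down: `κ(n q₁ q₂)` locally trivial above `q₂` would be a class of `Sel_{n q₁} = 0`
    have hT : T q₁ (κ n) := by rw [h]; exact hT0 q₁
    have h' := hOut (insert q₁ n) q₂ μ'' _ hq₂ hmem'' (hrec.mp hT)
    rw [hbot μ'', Submodule.mem_bot] at h'
    exact h0 h'

/-- **Propagation along RUNGS** (the coarsening of Howard's core graph available from the congruence form alone): along
the equivalence closure of the rung relation «`b = a ∪ {q₁, q₂}`, `q₁ ∉ a`, `q₂ ∉ a ∪ q₁`, `Sel_{a∪q₁}^± = 0`» (inline, no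
definition), starting from an EVEN vertex, `κ ≠ 0` is invariant — granted the congruence at every even bottom level and
`κ(n) ∈ Sel_n^{some sign}` at every even level. [cite: WZhang2014, Thm. 4.3, §9] [cite: Howard2006Bipartite, Cor. 2.4.12] -/
theorem even_iff_and_ne_zero_iff_of_eqvGen_rung
    (hIn : ∀ (n : Finset Q) (q : Q) (μ : Bool) (y : H), q ∉ n → y ∈ Sel n μ → T q y → y ∈ Sel (insert q n) μ)
    (hOut : ∀ (n : Finset Q) (q : Q) (μ : Bool) (z : H), q ∉ n → z ∈ Sel (insert q n) μ → T q z → z ∈ Sel n μ)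
    (hT0 : ∀ q, T q 0)
    (hrec : ∀ (n : Finset Q) (q₁ q₂ : Q), q₁ ∉ n → q₂ ∉ insert q₁ n → Even n.card →
      (T q₁ (κ n) ↔ T q₂ (κ (insert q₂ (insert q₁ n)))))
    (hmem : ∀ n : Finset Q, Even n.card → ∃ μ, κ n ∈ Sel n μ) {a b : Finset Q}
    (h : Relation.EqvGen (fun a b : Finset Q ↦ ∃ q₁ q₂, q₁ ∉ a ∧ q₂ ∉ insert q₁ a ∧ b = insert q₂ (insert q₁ a) ∧
        Sel (insert q₁ a) true = ⊥ ∧ Sel (insert q₁ a) false = ⊥) a b) :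
    (Even a.card ↔ Even b.card) ∧ (Even a.card → (κ a ≠ 0 ↔ κ b ≠ 0)) := by
  induction h with
  | rel x y hxy =>
    obtain ⟨q₁, q₂, hq₁, hq₂, rfl, htrue, hfalse⟩ := hxy
    have hpar := Method2EvenLevels.even_card_insert_insert_iff (n := x) hq₁ hq₂
    refine ⟨hpar.symm, fun hx ↦ ?_⟩
    obtain ⟨μ, hμ⟩ := hmem x hx
    obtain ⟨μ'', hμ''⟩ := hmem _ (hpar.mpr hx)
    exact ne_zero_iff_of_rung Sel T κ hIn hOut hT0 hq₁ hq₂ (hrec x q₁ q₂ hq₁ hq₂ hx) hμ hμ'' htrue hfalse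
  | refl x => exact ⟨Iff.rfl, fun _ ↦ Iff.rfl⟩
  | symm x y _ ih => exact ⟨ih.1.symm, fun hy ↦ (ih.2 (ih.1.mpr hy)).symm⟩
  | trans x y z _ _ ih₁ ih₂ => exact ⟨ih₁.1.trans ih₂.1, fun hx ↦ (ih₁.2 hx).trans (ih₂.2 (ih₁.1.mp hx))⟩

/-- **Class ⟹ class along rungs**: from an even vertex `a` with `κ(a) ≠ 0`, every vertex `b` rung-connected to `a` is even
and has `κ(b) ≠ 0`. [cite: WZhang2014, Thm. 4.3, Thm. 7.2, §9] [cite: Howard2006Bipartite, Cor. 2.4.12] -/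
theorem ne_zero_of_eqvGen_rung
    (hIn : ∀ (n : Finset Q) (q : Q) (μ : Bool) (y : H), q ∉ n → y ∈ Sel n μ → T q y → y ∈ Sel (insert q n) μ)
    (hOut : ∀ (n : Finset Q) (q : Q) (μ : Bool) (z : H), q ∉ n → z ∈ Sel (insert q n) μ → T q z → z ∈ Sel n μ)
    (hT0 : ∀ q, T q 0)
    (hrec : ∀ (n : Finset Q) (q₁ q₂ : Q), q₁ ∉ n → q₂ ∉ insert q₁ n → Even n.card →
      (T q₁ (κ n) ↔ T q₂ (κ (insert q₂ (insert q₁ n)))))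
    (hmem : ∀ n : Finset Q, Even n.card → ∃ μ, κ n ∈ Sel n μ) {a b : Finset Q} (ha : Even a.card) (h0 : κ a ≠ 0)
    (h : Relation.EqvGen (fun a b : Finset Q ↦ ∃ q₁ q₂, q₁ ∉ a ∧ q₂ ∉ insert q₁ a ∧ b = insert q₂ (insert q₁ a) ∧
        Sel (insert q₁ a) true = ⊥ ∧ Sel (insert q₁ a) false = ⊥) a b) :
    Even b.card ∧ κ b ≠ 0 :=
  have H := even_iff_and_ne_zero_iff_of_eqvGen_rung Sel T κ hIn hOut hT0 hrec hmem h
  ⟨H.1.mp ha, (H.2 ha).mp h0⟩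

end Summit.BirchSwinnertonDyer.Rank1Residual.X11b.Three.Koly.CoreGraph


/-! # Appendix (width seat w2 g2, appended): propagation with membership only at NON-EMPTY levels

The seed assemblies built on this file ask `κ(n) ∈ Sel_n^{some sign}` at EVERY even level, including `∅`, where the carrier's
local axioms are silent (hence their binder `selmer_bottom`). Howard's paths between NON-EMPTY core levels never visit `∅`
(Lemma 2.4.10 joins `a` to `n ⊇ a` through levels containing `a`), so it suffices to propagate along the core-edge relation
with the extra conjunct «the lower end is non-empty», asking membership only at non-empty even levels. -/

namespace Summit.BirchSwinnertonDyer.Rank1Residual.X11b.Three.Koly.CoreGraph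

section Propagate

variable {F : Type*} [Semiring F] {H : Type*} [AddCommGroup H] [Module F H] {Q : Type*} [DecidableEq Q]
  (Sel : Finset Q → Bool → Submodule F H) (T : Q → H → Prop) (κ : Finset Q → H) (Λ : Finset Q → Prop)

/-! ## §1 Propagation with membership only at non-empty levels -/

/-- **PROPAGATION along the core graph restricted to non-empty lower ends** — part 1's `propagate_of_eqvGen` with the
membership hypothesis asked only at NON-EMPTY even levels (the relation's extra conjunct guarantees every visited level is
non-empty). [cite: Howard2006Bipartite, Cor. 2.3.5, Cor. 2.4.12] -/
theorem propagate_of_eqvGen_ne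
    (hIn : ∀ (n : Finset Q) (q : Q) (μ : Bool) (y : H), q ∉ n → y ∈ Sel n μ → T q y → y ∈ Sel (insert q n) μ)
    (hOut : ∀ (n : Finset Q) (q : Q) (μ : Bool) (z : H), q ∉ n → z ∈ Sel (insert q n) μ → T q z → z ∈ Sel n μ)
    (hT0 : ∀ q, T q 0)
    (lawA : ∀ (n : Finset Q) (q : Q), Even n.card → q ∉ n → (¬ T q (κ n) ↔ Λ (insert q n)))
    (lawB : ∀ (n' : Finset Q) (q : Q), Odd n'.card → q ∉ n' → (¬ T q (κ (insert q n')) ↔ Λ n'))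
    (hmem : ∀ n : Finset Q, n.Nonempty → Even n.card → ∃ μ, κ n ∈ Sel n μ) {a b : Finset Q}
    (h : Relation.EqvGen (fun a b : Finset Q ↦ a.Nonempty ∧ ∃ q, q ∉ a ∧ b = insert q a ∧
        (Even a.card → Sel (insert q a) true = ⊥ ∧ Sel (insert q a) false = ⊥) ∧
        (Odd a.card → Sel a true = ⊥ ∧ Sel a false = ⊥)) a b) :
    ((Even a.card → κ a ≠ 0) ∧ (Odd a.card → Λ a)) ↔ ((Even b.card → κ b ≠ 0) ∧ (Odd b.card → Λ b)) := by
  induction h with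
  | rel x y hxy =>
    obtain ⟨hxne, q, hqx, rfl, hev, hod⟩ := hxy
    rcases Nat.even_or_odd x.card with hx | hx
    · -- `x` even, below the odd core vertex `x ∪ {q}`
      obtain ⟨htrue, hfalse⟩ := hev hx
      obtain ⟨μ, hμ⟩ := hmem x hxne hx
      have hbot : Sel (insert q x) μ = ⊥ := by
        cases μ
        · exact hfalse
        · exact htrue
      have key := ne_zero_iff_value_above Sel T κ Λ hIn hT0 lawA hx hqx hμ hbot
      have hy : Odd (insert q x).card := by rw [Finset.card_insert_of_notMem hqx]; exact hx.add_one
      have hy' : ¬ Even (insert q x).card := Nat.not_even_iff_odd.mpr hy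
      have hx' : ¬ Odd x.card := Nat.not_odd_iff_even.mpr hx
      exact ⟨fun h ↦ ⟨fun he ↦ absurd he hy', fun _ ↦ key.mp (h.1 hx)⟩,
        fun h ↦ ⟨fun _ ↦ key.mpr (h.2 hy), fun ho ↦ absurd ho hx'⟩⟩
    · -- `x` odd core, `x ∪ {q}` even above it
      obtain ⟨htrue, hfalse⟩ := hod hx
      have hy : Even (insert q x).card := by rw [Finset.card_insert_of_notMem hqx]; exact hx.add_one
      obtain ⟨μ, hμ⟩ := hmem _ (Finset.insert_nonempty q x) hy
      have hbot : Sel x μ = ⊥ := by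
        cases μ
        · exact hfalse
        · exact htrue
      have key := ne_zero_iff_value_below Sel T κ Λ hOut hT0 lawB hx hqx hμ hbot
      have hy' : ¬ Odd (insert q x).card := Nat.not_odd_iff_even.mpr hy
      have hx' : ¬ Even x.card := Nat.not_even_iff_odd.mpr hx
      exact ⟨fun h ↦ ⟨fun _ ↦ key.mpr (h.2 hx), fun ho ↦ absurd ho hy'⟩,
        fun h ↦ ⟨fun he ↦ absurd he hx', fun _ ↦ key.mp (h.1 hy)⟩⟩
  | refl x => exact Iff.rfl
  | symm x y _ ih => exact ih.symm
  | trans x y z _ _ ih₁ ih₂ => exact ih₁.trans ih₂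

/-- **Class ⟹ class on NON-EMPTY levels**: as `ne_zero_of_eqvGen`, along the core-edge relation restricted to non-empty
lower ends, with the membership hypothesis asked only at non-empty even levels. [cite: Howard2006Bipartite, Cor. 2.4.12] -/
theorem ne_zero_of_eqvGen_ne
    (hIn : ∀ (n : Finset Q) (q : Q) (μ : Bool) (y : H), q ∉ n → y ∈ Sel n μ → T q y → y ∈ Sel (insert q n) μ)
    (hOut : ∀ (n : Finset Q) (q : Q) (μ : Bool) (z : H), q ∉ n → z ∈ Sel (insert q n) μ → T q z → z ∈ Sel n μ)
    (hT0 : ∀ q, T q 0)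
    (lawA : ∀ (n : Finset Q) (q : Q), Even n.card → q ∉ n → (¬ T q (κ n) ↔ Λ (insert q n)))
    (lawB : ∀ (n' : Finset Q) (q : Q), Odd n'.card → q ∉ n' → (¬ T q (κ (insert q n')) ↔ Λ n'))
    (hmem : ∀ n : Finset Q, n.Nonempty → Even n.card → ∃ μ, κ n ∈ Sel n μ) {n₀ n : Finset Q} (hn₀ : Even n₀.card)
    (h0 : κ n₀ ≠ 0) (hn : Even n.card)
    (hpath : Relation.EqvGen (fun a b : Finset Q ↦ a.Nonempty ∧ ∃ q, q ∉ a ∧ b = insert q a ∧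
        (Even a.card → Sel (insert q a) true = ⊥ ∧ Sel (insert q a) false = ⊥) ∧
        (Odd a.card → Sel a true = ⊥ ∧ Sel a false = ⊥)) n₀ n) : κ n ≠ 0 :=
  ((propagate_of_eqvGen_ne Sel T κ Λ hIn hOut hT0 lawA lawB hmem hpath).mp
    ⟨fun _ ↦ h0, fun ho ↦ absurd ho (Nat.not_odd_iff_even.mpr hn₀)⟩).1 hn

/-- **ONE value ⟹ class on NON-EMPTY levels**: as `ne_zero_of_eqvGen_of_value`, along the restricted relation.
[cite: Howard2006Bipartite, Thm. 2.5.1] -/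
theorem ne_zero_of_eqvGen_of_value_ne
    (hIn : ∀ (n : Finset Q) (q : Q) (μ : Bool) (y : H), q ∉ n → y ∈ Sel n μ → T q y → y ∈ Sel (insert q n) μ)
    (hOut : ∀ (n : Finset Q) (q : Q) (μ : Bool) (z : H), q ∉ n → z ∈ Sel (insert q n) μ → T q z → z ∈ Sel n μ)
    (hT0 : ∀ q, T q 0)
    (lawA : ∀ (n : Finset Q) (q : Q), Even n.card → q ∉ n → (¬ T q (κ n) ↔ Λ (insert q n)))
    (lawB : ∀ (n' : Finset Q) (q : Q), Odd n'.card → q ∉ n' → (¬ T q (κ (insert q n')) ↔ Λ n'))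
    (hmem : ∀ n : Finset Q, n.Nonempty → Even n.card → ∃ μ, κ n ∈ Sel n μ) {n₀' n : Finset Q} (hn₀' : Odd n₀'.card)
    (h0 : Λ n₀') (hn : Even n.card)
    (hpath : Relation.EqvGen (fun a b : Finset Q ↦ a.Nonempty ∧ ∃ q, q ∉ a ∧ b = insert q a ∧
        (Even a.card → Sel (insert q a) true = ⊥ ∧ Sel (insert q a) false = ⊥) ∧
        (Odd a.card → Sel a true = ⊥ ∧ Sel a false = ⊥)) n₀' n) : κ n ≠ 0 :=
  ((propagate_of_eqvGen_ne Sel T κ Λ hIn hOut hT0 lawA lawB hmem hpath).mp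
    ⟨fun he ↦ absurd he (Nat.not_even_iff_odd.mpr hn₀'), fun _ ↦ h0⟩).1 hn


end Propagate

end Summit.BirchSwinnertonDyer.Rank1Residual.X11b.Three.Koly.CoreGraph

end
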